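import Summits.BirchSwinnertonDyer.BirchSwinnertonDyer.Theorems.ByReductionTypeAtTwoRankOneAtTwoBigImageOddLocalFklClauseA
import Summits.BirchSwinnertonDyer.Rank1Residual.F1Sign2.FirstLayerLawAtTwoGlue
import HarnessLib

/-!
# Line `fkl` of crux `RankOneAtTwoBigImageOddLocal` (stmt-BirchSwinnertonDyer-23715, route ByReductionTypeAtTwo):
# the OPEN RESIDUES of K2-F / K2-F_an, and the CROSSWISE use of the four residues

Lead prover seat `bsd-line-fkl-p1` (g2), helpers `--supports stmt-BirchSwinnertonDyer-23715` (skeleton v7 of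
`Cruxes/RankOneAtTwoBigImageOddLocal/Lines/fkl.lean` registers the four residues below as stubs).

After g0 (`…FklClauseA`, p595057: clause (a) of both laws holds mod `2` always, hence verbatim at level `k = 1` and for
parameter `0`) the OPEN content of the hardest stub K2-F `F1Sign2.FirstLayerLawAtTwo` — and of its analytic twin
`F1Sign2.AnalyticFirstLayerLawAtTwo` — is exactly two statements each, under the law's own binders:
* **(HC) higher congruence** — for parameter `s ≥ 1`, every row `(ℓ, k, ψ)` of the first layer with `k ≥ 2` has
  `δ'_k(ℓ; ψ) ∈ 2^{min(k, s+1)} ℤ_{(2)}` (Kolyvagin direction: a large `Ш[2^∞]` forces divisibility);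
* **(NV) non-vanishing** — some row with `k ≥ s + 2` has `δ'_k(ℓ; ψ) ∉ 2^{s+2} ℤ_{(2)}` (Kolyvagin non-triviality at `2`).
`firstLayerLawAtTwo_of_residues` / `analyticFirstLayerLawAtTwo_of_residues` (and the trivial converses
`residues_of_firstLayerLawAtTwo` / `residues_of_analyticFirstLayerLawAtTwo`) make this kernel-exact: K2-F ⟺ HC ∧ NV and
K2-F_an ⟺ HC_an ∧ NV_an, given only g0's theorems.
CROSSWISE USE (`param_le_of_clauseA_of_clauseB`, the one-sided half of the tree's minimum-exponent argument
`F1Sign2.param_eq_of_two_laws`): clause (a) with parameter `s` and clause (b) with parameter `s'` over one first layer force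
`s ≤ s'`.  Hence, per curve (`sha_two_val_le_of_clauseA_of_analyticClauseB`, `shaAn_two_val_le_of_analyticClauseA_of_clauseB`):
«`ord₂ #Ш[2^∞] ≤ ord₂ Ш_an`» — the KOLYVAGIN–KATO direction of BSD₂ — uses only the ALGEBRAIC clause (a) and the ANALYTIC
clause (b); «`ord₂ Ш_an ≤ ord₂ #Ш[2^∞]`» — the main-conjecture direction — uses only the ALGEBRAIC clause (b) and the ANALYTIC
clause (a).  Theorems only; no `def`, no named-fact hypothesis, no `sorry`.  BSD is not proved by any of this.
-/

set_option autoImplicit false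

noncomputable section

open scoped Classical MatrixGroups ModularForm

set_option linter.dupNamespace false

namespace Summit.BirchSwinnertonDyer.BirchSwinnertonDyer.Theorems.RankOneAtTwoFkl

open CongruenceSubgroup WeierstrassCurve Literature.NumberTheory.EllipticCurves
  Literature.NumberTheory.EllipticCurves.ModularForms Summit.BirchSwinnertonDyer.Rank1Residual.F1Sign2

/-! ## The one-sided minimum-exponent argument -/

/-- **One-sided minimum-exponent argument.**  Over one family of numbers `x i` with levels `lev i`: clause (a) with
parameter `s` («every admissible row has `x ∈ 2^{min(lev, s+1)} ℤ_{(2)}`») and clause (b) with parameter `s'` («some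
admissible row of level `≥ s'+2` has `x ∉ 2^{s'+2} ℤ_{(2)}`») force `s ≤ s'`.  (The tree's `F1Sign2.param_eq_of_two_laws`
is this lemma applied both ways.) [folklore] -/
theorem param_le_of_clauseA_of_clauseB {ι : Type*} (adm : ι → Prop) (lev : ι → ℕ) (x : ι → ℚ) (s s' : ℕ)
    (ha : ∀ i, adm i → InTwoPowZLoc (min (lev i) (s + 1)) (x i))
    (hb' : ∃ i, adm i ∧ s' + 2 ≤ lev i ∧ ¬ InTwoPowZLoc (s' + 2) (x i)) : s ≤ s' := by
  by_contra hlt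
  obtain ⟨i, hi, hk, hnot⟩ := hb'
  have h1 : InTwoPowZLoc (min (lev i) (s + 1)) (x i) := ha i hi
  have h2 : s' + 2 ≤ min (lev i) (s + 1) := le_min hk (by omega)
  exact hnot (inTwoPowZLoc_mono h2 h1)

/-- **Crosswise, per curve: `ord₂ #Ш(E)[2^∞] ≤ ord₂ Ш_an` from the ALGEBRAIC clause (a) and the ANALYTIC clause (b)** of the
first layer of `(W, f)` (the Kolyvagin–Kato direction of BSD₂ in first-layer currency; `q` = the rational value of `Ш_an`,
`s_an = (ord₂ q).toNat`).  Pure logic. [folklore] -/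
theorem sha_two_val_le_of_clauseA_of_analyticClauseB (W : WeierstrassCurve ℚ) [W.IsElliptic] [W.IsGloballyMinimal]
    {M : ℕ} (f : CuspForm (Gamma0 M) 2) (q : ℚ)
    (ha : let s := padicValNat 2 (Nat.card (AddCommGroup.primaryComponent W.sha 2))
      ∀ (ℓ k : ℕ) [Fact ℓ.Prime], IsLevelAtTwo W ℓ → 1 ≤ k → (2 ^ k : ℤ) ∣ (ℓ : ℤ) - 1 →
        (2 ^ k : ℤ) ∣ W.frobeniusTrace ℓ - 2 →
        ∀ ψ : (ZMod ℓ)ˣ →* Multiplicative (ZMod (2 ^ k)), Function.Surjective ψ →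
          InTwoPowZLoc (min k (s + 1)) (levelSumTwo f ℓ k ψ))
    (hb : let s := (padicValRat 2 q).toNat
      ∃ (ℓ k : ℕ) (_ : Fact ℓ.Prime) (ψ : (ZMod ℓ)ˣ →* Multiplicative (ZMod (2 ^ k))),
        IsLevelAtTwo W ℓ ∧ s + 2 ≤ k ∧ (2 ^ k : ℤ) ∣ (ℓ : ℤ) - 1 ∧ (2 ^ k : ℤ) ∣ W.frobeniusTrace ℓ - 2 ∧
        Function.Surjective ψ ∧ ¬ InTwoPowZLoc (s + 2) (levelSumTwo f ℓ k ψ)) :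
    padicValNat 2 (Nat.card (AddCommGroup.primaryComponent W.sha 2)) ≤ (padicValRat 2 q).toNat := by
  simp only at ha hb
  obtain ⟨ℓ, k, hℓ, ψ, hlev, hk, hd1, hd2, hψ, hnot⟩ := hb
  let ι := (l : ℕ) × (j : ℕ) × (PLift (Fact l.Prime) × ((ZMod l)ˣ →* Multiplicative (ZMod (2 ^ j))))
  let adm : ι → Prop := fun i =>
    haveI : Fact i.1.Prime := i.2.2.1.down
    IsLevelAtTwo W i.1 ∧ 1 ≤ i.2.1 ∧ (2 ^ i.2.1 : ℤ) ∣ (i.1 : ℤ) - 1 ∧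
      (2 ^ i.2.1 : ℤ) ∣ W.frobeniusTrace i.1 - 2 ∧ Function.Surjective i.2.2.2
  let x : ι → ℚ := fun i =>
    haveI : Fact i.1.Prime := i.2.2.1.down
    levelSumTwo f i.1 i.2.1 i.2.2.2
  refine param_le_of_clauseA_of_clauseB adm (fun i => i.2.1) x _ _ ?_
    ⟨⟨ℓ, k, ⟨hℓ⟩, ψ⟩, ⟨hlev, (show 1 ≤ k by omega), hd1, hd2, hψ⟩, hk, hnot⟩
  rintro ⟨l, j, ⟨hl⟩, φ⟩ ⟨h1, h2, h3, h4, h5⟩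
  exact @ha l j hl h1 h2 h3 h4 φ h5

/-- **Crosswise, per curve: `ord₂ Ш_an ≤ ord₂ #Ш(E)[2^∞]` from the ANALYTIC clause (a) and the ALGEBRAIC clause (b)** of the
first layer of `(W, f)` (the main-conjecture direction of BSD₂ in first-layer currency).  Pure logic. [folklore] -/
theorem shaAn_two_val_le_of_analyticClauseA_of_clauseB (W : WeierstrassCurve ℚ) [W.IsElliptic] [W.IsGloballyMinimal]
    {M : ℕ} (f : CuspForm (Gamma0 M) 2) (q : ℚ)
    (ha : let s := (padicValRat 2 q).toNat
      ∀ (ℓ k : ℕ) [Fact ℓ.Prime], IsLevelAtTwo W ℓ → 1 ≤ k → (2 ^ k : ℤ) ∣ (ℓ : ℤ) - 1 →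
        (2 ^ k : ℤ) ∣ W.frobeniusTrace ℓ - 2 →
        ∀ ψ : (ZMod ℓ)ˣ →* Multiplicative (ZMod (2 ^ k)), Function.Surjective ψ →
          InTwoPowZLoc (min k (s + 1)) (levelSumTwo f ℓ k ψ))
    (hb : let s := padicValNat 2 (Nat.card (AddCommGroup.primaryComponent W.sha 2))
      ∃ (ℓ k : ℕ) (_ : Fact ℓ.Prime) (ψ : (ZMod ℓ)ˣ →* Multiplicative (ZMod (2 ^ k))),
        IsLevelAtTwo W ℓ ∧ s + 2 ≤ k ∧ (2 ^ k : ℤ) ∣ (ℓ : ℤ) - 1 ∧ (2 ^ k : ℤ) ∣ W.frobeniusTrace ℓ - 2 ∧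
        Function.Surjective ψ ∧ ¬ InTwoPowZLoc (s + 2) (levelSumTwo f ℓ k ψ)) :
    (padicValRat 2 q).toNat ≤ padicValNat 2 (Nat.card (AddCommGroup.primaryComponent W.sha 2)) := by
  simp only at ha hb
  obtain ⟨ℓ, k, hℓ, ψ, hlev, hk, hd1, hd2, hψ, hnot⟩ := hb
  let ι := (l : ℕ) × (j : ℕ) × (PLift (Fact l.Prime) × ((ZMod l)ˣ →* Multiplicative (ZMod (2 ^ j))))
  let adm : ι → Prop := fun i =>
    haveI : Fact i.1.Prime := i.2.2.1.down
    IsLevelAtTwo W i.1 ∧ 1 ≤ i.2.1 ∧ (2 ^ i.2.1 : ℤ) ∣ (i.1 : ℤ) - 1 ∧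
      (2 ^ i.2.1 : ℤ) ∣ W.frobeniusTrace i.1 - 2 ∧ Function.Surjective i.2.2.2
  let x : ι → ℚ := fun i =>
    haveI : Fact i.1.Prime := i.2.2.1.down
    levelSumTwo f i.1 i.2.1 i.2.2.2
  refine param_le_of_clauseA_of_clauseB adm (fun i => i.2.1) x _ _ ?_
    ⟨⟨ℓ, k, ⟨hℓ⟩, ψ⟩, ⟨hlev, (show 1 ≤ k by omega), hd1, hd2, hψ⟩, hk, hnot⟩
  rintro ⟨l, j, ⟨hl⟩, φ⟩ ⟨h1, h2, h3, h4, h5⟩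
  exact @ha l j hl h1 h2 h3 h4 φ h5

/-! ## K2-F ⟺ (HC) ∧ (NV) given g0's mod-2 theorem -/

/-- **K2-F from its two open residues.**  The hardest stub `F1Sign2.FirstLayerLawAtTwo` follows from
(HC) the higher congruence «parameter `s ≥ 1`, level `k ≥ 2` ⇒ `δ'_k(ℓ;ψ) ∈ 2^{min(k,s+1)} ℤ_{(2)}`» and
(NV) the non-vanishing «some row of level `≥ s+2` has `δ' ∉ 2^{s+2} ℤ_{(2)}`», both under K2-F's own binders: the remaining
rows of clause (a) (`s = 0` or `k = 1`, where `min(k, s+1) = 1`) are g0's theorem `firstLayerLawAtTwo_clauseA_mod_two`.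
[conjecture] residues in, kernel glue. -/
theorem firstLayerLawAtTwo_of_residues
    (hHC : ∀ (W : WeierstrassCurve ℚ) [W.IsElliptic] [W.IsGloballyMinimal] {M : ℕ} [NeZero M]
      (f : CuspForm (Gamma0 M) 2), IsNewformOf W f → PeriodTransferAtTwo W f →
      (∀ n : ℕ, W.HasSurjectiveModNGaloisRep ((2 ^ n : ℕ) : ℤ)) → Odd W.torsionOrder → Odd W.tamagawaProduct →
      W.rootNumber = -1 → W.mordellWeilRank = 1 → Finite (AddCommGroup.primaryComponent W.sha 2) →
      let s := padicValNat 2 (Nat.card (AddCommGroup.primaryComponent W.sha 2))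
      1 ≤ s → ∀ (ℓ k : ℕ) [Fact ℓ.Prime], IsLevelAtTwo W ℓ → 2 ≤ k → (2 ^ k : ℤ) ∣ (ℓ : ℤ) - 1 →
        (2 ^ k : ℤ) ∣ W.frobeniusTrace ℓ - 2 →
        ∀ ψ : (ZMod ℓ)ˣ →* Multiplicative (ZMod (2 ^ k)), Function.Surjective ψ →
          InTwoPowZLoc (min k (s + 1)) (levelSumTwo f ℓ k ψ))
    (hNV : ∀ (W : WeierstrassCurve ℚ) [W.IsElliptic] [W.IsGloballyMinimal] {M : ℕ} [NeZero M]
      (f : CuspForm (Gamma0 M) 2), IsNewformOf W f → PeriodTransferAtTwo W f →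
      (∀ n : ℕ, W.HasSurjectiveModNGaloisRep ((2 ^ n : ℕ) : ℤ)) → Odd W.torsionOrder → Odd W.tamagawaProduct →
      W.rootNumber = -1 → W.mordellWeilRank = 1 → Finite (AddCommGroup.primaryComponent W.sha 2) →
      let s := padicValNat 2 (Nat.card (AddCommGroup.primaryComponent W.sha 2))
      ∃ (ℓ k : ℕ) (_ : Fact ℓ.Prime) (ψ : (ZMod ℓ)ˣ →* Multiplicative (ZMod (2 ^ k))),
        IsLevelAtTwo W ℓ ∧ s + 2 ≤ k ∧ (2 ^ k : ℤ) ∣ (ℓ : ℤ) - 1 ∧ (2 ^ k : ℤ) ∣ W.frobeniusTrace ℓ - 2 ∧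
        Function.Surjective ψ ∧ ¬ InTwoPowZLoc (s + 2) (levelSumTwo f ℓ k ψ)) :
    FirstLayerLawAtTwo := by
  intro W _ _ M _ f hf hper hsurj hT hc hw hr hfin
  refine ⟨?_, hNV W f hf hper hsurj hT hc hw hr hfin⟩
  intro ℓ k _ hlev hk hℓk ha ψ hψ
  have h1 : InTwoPowZLoc 1 (levelSumTwo f ℓ k ψ) :=
    firstLayerLawAtTwo_clauseA_mod_two W f hf hper hsurj hT hc hw hr hfin ℓ k hlev hk hℓk ha ψ hψ
  by_cases hs : 1 ≤ padicValNat 2 (Nat.card (AddCommGroup.primaryComponent W.sha 2))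
  · by_cases hk2 : 2 ≤ k
    · exact hHC W f hf hper hsurj hT hc hw hr hfin hs ℓ k hlev hk2 hℓk ha ψ hψ
    · have hmin : min k (padicValNat 2 (Nat.card (AddCommGroup.primaryComponent W.sha 2)) + 1) = 1 := by omega
      rw [hmin]
      exact h1
  · have hmin : min k (padicValNat 2 (Nat.card (AddCommGroup.primaryComponent W.sha 2)) + 1) = 1 := by omega
    rw [hmin]
    exact h1

/-- **The residues (HC) ∧ (NV) from K2-F** (trivial converse, recorded so that the reshape is an EQUIVALENCE).
[conjecture] in, kernel glue. -/
theorem residues_of_firstLayerLawAtTwo (hF : FirstLayerLawAtTwo) :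
    (∀ (W : WeierstrassCurve ℚ) [W.IsElliptic] [W.IsGloballyMinimal] {M : ℕ} [NeZero M]
      (f : CuspForm (Gamma0 M) 2), IsNewformOf W f → PeriodTransferAtTwo W f →
      (∀ n : ℕ, W.HasSurjectiveModNGaloisRep ((2 ^ n : ℕ) : ℤ)) → Odd W.torsionOrder → Odd W.tamagawaProduct →
      W.rootNumber = -1 → W.mordellWeilRank = 1 → Finite (AddCommGroup.primaryComponent W.sha 2) →
      let s := padicValNat 2 (Nat.card (AddCommGroup.primaryComponent W.sha 2))
      1 ≤ s → ∀ (ℓ k : ℕ) [Fact ℓ.Prime], IsLevelAtTwo W ℓ → 2 ≤ k → (2 ^ k : ℤ) ∣ (ℓ : ℤ) - 1 →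
        (2 ^ k : ℤ) ∣ W.frobeniusTrace ℓ - 2 →
        ∀ ψ : (ZMod ℓ)ˣ →* Multiplicative (ZMod (2 ^ k)), Function.Surjective ψ →
          InTwoPowZLoc (min k (s + 1)) (levelSumTwo f ℓ k ψ)) ∧
    (∀ (W : WeierstrassCurve ℚ) [W.IsElliptic] [W.IsGloballyMinimal] {M : ℕ} [NeZero M]
      (f : CuspForm (Gamma0 M) 2), IsNewformOf W f → PeriodTransferAtTwo W f →
      (∀ n : ℕ, W.HasSurjectiveModNGaloisRep ((2 ^ n : ℕ) : ℤ)) → Odd W.torsionOrder → Odd W.tamagawaProduct →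
      W.rootNumber = -1 → W.mordellWeilRank = 1 → Finite (AddCommGroup.primaryComponent W.sha 2) →
      let s := padicValNat 2 (Nat.card (AddCommGroup.primaryComponent W.sha 2))
      ∃ (ℓ k : ℕ) (_ : Fact ℓ.Prime) (ψ : (ZMod ℓ)ˣ →* Multiplicative (ZMod (2 ^ k))),
        IsLevelAtTwo W ℓ ∧ s + 2 ≤ k ∧ (2 ^ k : ℤ) ∣ (ℓ : ℤ) - 1 ∧ (2 ^ k : ℤ) ∣ W.frobeniusTrace ℓ - 2 ∧
        Function.Surjective ψ ∧ ¬ InTwoPowZLoc (s + 2) (levelSumTwo f ℓ k ψ)) := by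
  refine ⟨?_, ?_⟩
  · intro W _ _ M _ f hf hper hsurj hT hc hw hr hfin
    have HF := hF W f hf hper hsurj hT hc hw hr hfin
    simp only at HF ⊢
    intro _hs ℓ k _ hlev hk hℓk ha ψ hψ
    exact HF.1 ℓ k hlev (by omega) hℓk ha ψ hψ
  · intro W _ _ M _ f hf hper hsurj hT hc hw hr hfin
    exact (hF W f hf hper hsurj hT hc hw hr hfin).2

/-! ## K2-F_an ⟺ (HC_an) ∧ (NV_an) given g0's mod-2 theorem -/

/-- **K2-F_an from its two open residues** (analytic rank one, `s_an = (ord₂ q).toNat` for the rational value `q ≠ 0` of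
`Ш_an`): (HC_an) for `s_an ≥ 1`, `k ≥ 2`, and (NV_an); the rows with `min(k, s_an+1) = 1` are g0's
`analyticFirstLayerLawAtTwo_clauseA_mod_two`. [conjecture] residues in, kernel glue. -/
theorem analyticFirstLayerLawAtTwo_of_residues
    (hHC : ∀ (W : WeierstrassCurve ℚ) [W.IsElliptic] [W.IsGloballyMinimal] {M : ℕ} [NeZero M]
      (f : CuspForm (Gamma0 M) 2), IsNewformOf W f → PeriodTransferAtTwo W f →
      (∀ n : ℕ, W.HasSurjectiveModNGaloisRep ((2 ^ n : ℕ) : ℤ)) → Odd W.torsionOrder → Odd W.tamagawaProduct →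
      W.rootNumber = -1 → W.analyticRank = 1 →
      ∀ q : ℚ, shaAn W = (q : ℂ) → q ≠ 0 →
      let s := (padicValRat 2 q).toNat
      1 ≤ s → ∀ (ℓ k : ℕ) [Fact ℓ.Prime], IsLevelAtTwo W ℓ → 2 ≤ k → (2 ^ k : ℤ) ∣ (ℓ : ℤ) - 1 →
        (2 ^ k : ℤ) ∣ W.frobeniusTrace ℓ - 2 →
        ∀ ψ : (ZMod ℓ)ˣ →* Multiplicative (ZMod (2 ^ k)), Function.Surjective ψ →
          InTwoPowZLoc (min k (s + 1)) (levelSumTwo f ℓ k ψ))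
    (hNV : ∀ (W : WeierstrassCurve ℚ) [W.IsElliptic] [W.IsGloballyMinimal] {M : ℕ} [NeZero M]
      (f : CuspForm (Gamma0 M) 2), IsNewformOf W f → PeriodTransferAtTwo W f →
      (∀ n : ℕ, W.HasSurjectiveModNGaloisRep ((2 ^ n : ℕ) : ℤ)) → Odd W.torsionOrder → Odd W.tamagawaProduct →
      W.rootNumber = -1 → W.analyticRank = 1 →
      ∀ q : ℚ, shaAn W = (q : ℂ) → q ≠ 0 →
      let s := (padicValRat 2 q).toNat
      ∃ (ℓ k : ℕ) (_ : Fact ℓ.Prime) (ψ : (ZMod ℓ)ˣ →* Multiplicative (ZMod (2 ^ k))),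
        IsLevelAtTwo W ℓ ∧ s + 2 ≤ k ∧ (2 ^ k : ℤ) ∣ (ℓ : ℤ) - 1 ∧ (2 ^ k : ℤ) ∣ W.frobeniusTrace ℓ - 2 ∧
        Function.Surjective ψ ∧ ¬ InTwoPowZLoc (s + 2) (levelSumTwo f ℓ k ψ)) :
    AnalyticFirstLayerLawAtTwo := by
  intro W _ _ M _ f hf hper hsurj hT hc hw han q hq hq0
  refine ⟨?_, hNV W f hf hper hsurj hT hc hw han q hq hq0⟩
  intro ℓ k _ hlev hk hℓk ha ψ hψ
  have h1 : InTwoPowZLoc 1 (levelSumTwo f ℓ k ψ) :=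
    analyticFirstLayerLawAtTwo_clauseA_mod_two W f hf hper hsurj hT hc hw han q hq hq0 ℓ k hlev hk hℓk ha ψ hψ
  by_cases hs : 1 ≤ (padicValRat 2 q).toNat
  · by_cases hk2 : 2 ≤ k
    · exact hHC W f hf hper hsurj hT hc hw han q hq hq0 hs ℓ k hlev hk2 hℓk ha ψ hψ
    · have hmin : min k ((padicValRat 2 q).toNat + 1) = 1 := by omega
      rw [hmin]
      exact h1
  · have hmin : min k ((padicValRat 2 q).toNat + 1) = 1 := by omega
    rw [hmin]
    exact h1

/-- **The residues (HC_an) ∧ (NV_an) from K2-F_an** (trivial converse). [conjecture] in, kernel glue. -/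
theorem residues_of_analyticFirstLayerLawAtTwo (hA : AnalyticFirstLayerLawAtTwo) :
    (∀ (W : WeierstrassCurve ℚ) [W.IsElliptic] [W.IsGloballyMinimal] {M : ℕ} [NeZero M]
      (f : CuspForm (Gamma0 M) 2), IsNewformOf W f → PeriodTransferAtTwo W f →
      (∀ n : ℕ, W.HasSurjectiveModNGaloisRep ((2 ^ n : ℕ) : ℤ)) → Odd W.torsionOrder → Odd W.tamagawaProduct →
      W.rootNumber = -1 → W.analyticRank = 1 →
      ∀ q : ℚ, shaAn W = (q : ℂ) → q ≠ 0 →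
      let s := (padicValRat 2 q).toNat
      1 ≤ s → ∀ (ℓ k : ℕ) [Fact ℓ.Prime], IsLevelAtTwo W ℓ → 2 ≤ k → (2 ^ k : ℤ) ∣ (ℓ : ℤ) - 1 →
        (2 ^ k : ℤ) ∣ W.frobeniusTrace ℓ - 2 →
        ∀ ψ : (ZMod ℓ)ˣ →* Multiplicative (ZMod (2 ^ k)), Function.Surjective ψ →
          InTwoPowZLoc (min k (s + 1)) (levelSumTwo f ℓ k ψ)) ∧
    (∀ (W : WeierstrassCurve ℚ) [W.IsElliptic] [W.IsGloballyMinimal] {M : ℕ} [NeZero M]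
      (f : CuspForm (Gamma0 M) 2), IsNewformOf W f → PeriodTransferAtTwo W f →
      (∀ n : ℕ, W.HasSurjectiveModNGaloisRep ((2 ^ n : ℕ) : ℤ)) → Odd W.torsionOrder → Odd W.tamagawaProduct →
      W.rootNumber = -1 → W.analyticRank = 1 →
      ∀ q : ℚ, shaAn W = (q : ℂ) → q ≠ 0 →
      let s := (padicValRat 2 q).toNat
      ∃ (ℓ k : ℕ) (_ : Fact ℓ.Prime) (ψ : (ZMod ℓ)ˣ →* Multiplicative (ZMod (2 ^ k))),
        IsLevelAtTwo W ℓ ∧ s + 2 ≤ k ∧ (2 ^ k : ℤ) ∣ (ℓ : ℤ) - 1 ∧ (2 ^ k : ℤ) ∣ W.frobeniusTrace ℓ - 2 ∧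
        Function.Surjective ψ ∧ ¬ InTwoPowZLoc (s + 2) (levelSumTwo f ℓ k ψ)) := by
  refine ⟨?_, ?_⟩
  · intro W _ _ M _ f hf hper hsurj hT hc hw han q hq hq0
    have HA := hA W f hf hper hsurj hT hc hw han q hq hq0
    simp only at HA ⊢
    intro _hs ℓ k _ hlev hk hℓk ha ψ hψ
    exact HA.1 ℓ k hlev (by omega) hℓk ha ψ hψ
  · intro W _ _ M _ f hf hper hsurj hT hc hw han q hq hq0
    exact (hA W f hf hper hsurj hT hc hw han q hq hq0).2

end Summit.BirchSwinnertonDyer.BirchSwinnertonDyer.Theorems.RankOneAtTwoFkl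

end
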